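import Summits.AtomisticToContinuum.Crystallization.Theorems.FrustratedLawDichotomyStrainedPatchHomShearFramesDispatch
import Summits.AtomisticToContinuum.Crystallization.Theorems.FrustratedLawDichotomyStrainedPatchHomLatticeBoxHcp
import Summits.AtomisticToContinuum.Crystallization.Theorems.FrustratedLawDichotomyStrainedPatchHomIsometry

/-!
# Aperiodic strained patch — «HomFloorHcpZone»: the ZONE-RELATIVE energy-to-floor sockets `(box sum floor on Zh) ⟹ (H∣hcp, Zh)`, general frame and
# polar-factor (self-adjoint) forms, and the two dispatch fibres (cell decomp-a2c hand-2 g44, structural #46; DEF-FREE)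

The tree turns an hcp ENERGY certificate into the hcp FLOOR only ZONE-BLIND: #38 `…XiWindowQuot.homFloorHcp_of_prunedBoxSum Zh` concludes `HomFloorHcp Zh m` for
every `Zh` from a certificate quantified over ALL `(G, ξ)` (`‖G − 1‖ ≤ 1/4`, `‖ξ‖ ≤ 1/4`) — the zone hypothesis is discarded.  The frame-local window architecture
of record (critic rows 1647 (E1)–(E5), 1652 (L2); `…HomShearFrames`, #44 `…HomShearFramesDispatch`) consumes PER-`U`-BOX floors
`HomFloorHcp (box B G ∧ ‖ξ − σf B G‖ ≤ R B) m` (LOEW / signed-well leaf ball, near boxes; lens-5 g106 «SignedXiElim» `hcpEnergy_of_ballLeaves_signed` delivers the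
ENERGY floor on exactly this fibre) and `HomFloorHcp (box B G ∧ ∀ i, |ξ_i − a B i| ≤ b B i) m` (value leaf product box, far boxes), whose certificates hold ONLY on the
fibre.  This file supplies the missing (E→avg) sockets:

* §1 `homFloorHcp_of_prunedBoxSum_zone` — #38's socket with the certificate allowed to ASSUME `Zh G ξ` (pruning disjunct kept); `homFloorHcp_of_boxSum_zone` — the
  pure energy form (no pruning disjunct): `∀ G ξ, ‖G − 1‖ ≤ 1/4 → ‖ξ‖ ≤ 1/4 → Zh G ξ → m ≤ (box sums of record)/2 − e_W` ⟹ `HomFloorHcp Zh m`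
  (`ballAvg_xRec_eq_latticeSum_hcp` + `latticeSum_hcp_eq_boxSum_record`, as in #38).
* §2 ★★ POLAR-FACTOR FORM ON ROTATION-INVARIANT ZONES: the leaves are computed on SELF-ADJOINT positive `U` (sym-entry `U`-boxes); `forall_near_one_of_forall_selfAdjoint`
  (O(3) reduction, `…HomPolar`) + `pruneHcp_comp` / `norm_latPt_comp` / `norm_latPt_add_comp` transport the certificate from the polar factor `U` to `G = R ∘ U`
  PROVIDED the zone is invariant, `Zh (R ∘ U) ξ → Zh U ξ` (`homFloorHcp_of_prunedBoxSum_selfAdjoint_zone`, `homFloorHcp_of_boxSum_selfAdjoint_zone`).  Zones of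
  record are functions of the Gram data / bond lengths `‖G v‖` and satisfy it (`zoneInvariant_of_norm_map`: any zone that factors through `v ↦ ‖G v‖`).
* §3 ★★★ THE TWO DISPATCH FIBRES BY NAME (the `hNear` / `hFar` binders of #44 `homFloorHcp_of_dispatch` / #45's consumers): `homFloorHcp_leafBall_of_boxSum[_selfAdjoint]`
  (`Zh := box G ∧ ‖ξ − σ G‖ ≤ R`; self-adjoint form needs `box`, `σ` rotation-invariant) and `homFloorHcp_productBox_of_boxSum[_selfAdjoint]`
  (`Zh := box G ∧ ∀ i, |ξ_i − a_i| ≤ b_i`).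

All floors at the record window `[−7,7]³`, potential `effPot w₄₅ ω₄ (3/400)`, reference energy `e_W = −7175/10000 + 3/400` — verbatim #38's box sums.  Def-free; proofs are
#38 §2b's four-liners with the zone hypothesis threaded; 0 sorry; standard axioms.  `--supports stmt-AtomisticToContinuum-27623 --as helper`.  [folklore]
-/

noncomputable section

namespace Summit.AtomisticToContinuum.Crystallization.Theorems.FrustratedLawDichotomyStrainedPatchHomFloorHcpZone

open scoped BigOperators Classical RealInnerProductSpace
open Summit.AtomisticToContinuum.Crystallization.Theorems.FrustratedLawDichotomyRangeCut (Sep)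
open Summit.AtomisticToContinuum.Crystallization.Theorems.ChargedEnergyGapNegative (E3)
open Summit.AtomisticToContinuum.Crystallization.Theorems.FrustratedLawDichotomySchurCut (effPot w₄₅ ω₄)
open Summit.AtomisticToContinuum.Crystallization.Theorems.FrustratedLawDichotomyAveragingCut (ballAvg)
open Summit.AtomisticToContinuum.Crystallization.Theorems.FrustratedLawDichotomyAveragingRuleTightFree (TightNearCap BadNearCap)
open Summit.AtomisticToContinuum.Crystallization.Theorems.FrustratedLawDichotomyExemptAbsorption (ExemptNear)
open Summit.AtomisticToContinuum.Crystallization.Theorems.FrustratedLawDichotomyStrainedPatchHomSplit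
open Summit.AtomisticToContinuum.Crystallization.Theorems.FrustratedLawDichotomyStrainedPatchHomLattice (ballAvg_xRec_eq_latticeSum_hcp)
open Summit.AtomisticToContinuum.Crystallization.Theorems.FrustratedLawDichotomyStrainedPatchHomLatticeBoxHcp (latticeSum_hcp_eq_boxSum_record)
open Summit.AtomisticToContinuum.Crystallization.Theorems.FrustratedLawDichotomyStrainedPatchHomPolar (forall_near_one_of_forall_selfAdjoint norm_latPt_comp
  norm_latPt_add_comp)
open Summit.AtomisticToContinuum.Crystallization.Theorems.FrustratedLawDichotomyStrainedPatchHomIsometry (pruneHcp_comp)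
open Summit.AtomisticToContinuum.Crystallization.Theorems.FrustratedLawDichotomyStrainedPatchHomXiWindow

/-! ## §1. Zone-relative sockets, general frame -/

section General

variable (Zh : (E3 →L[ℝ] E3) → E3 → Prop) {m : ℝ}

/-- ★ **`(H∣hcp, Zh)` FROM A PRUNED BOX-SUM CERTIFICATE ON THE ZONE**: for every `(G, ξ)` with `‖G − 1‖ ≤ 1/4`, `‖ξ‖ ≤ 1/4` AND `Zh G ξ`, either every injective
enumeration of the `(G, ξ)`-hcp ball is not separated / has a tight / exempt / bad centre, or the box floor holds ⟹ the hcp floor on `Zh`.  (#38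
`homFloorHcp_of_prunedBoxSum` with the zone hypothesis threaded instead of discarded.) [folklore] -/
theorem homFloorHcp_of_prunedBoxSum_zone
    (hhcp : ∀ (G : E3 →L[ℝ] E3) (ξ : E3), ‖G - 1‖ ≤ 1 / 4 → ‖ξ‖ ≤ 1 / 4 → Zh G ξ →
      (∀ (M : ℕ) (z : Fin M → E3) (c : Fin M), Function.Injective z →
          Set.range z = {x : E3 | dist x (z c) ≤ 133 / 10 ∧ ∃ a : Fin 3 → ℤ,
            x = z c + latPt G hexFrame a ∨ x = z c + latPt G hexFrame a + G (hcpShift + ξ)} →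
          ¬Sep z ∨ TightNearCap (9 / 5) (3 / 2) z c ∨ ExemptNear (9 / 5) ExRec z c ∨ BadNearCap (9 / 5) (3 / 2) z c) ∨
      m ≤ (∑ b ∈ (Fintype.piFinset fun _ : Fin 3 => Finset.Icc (-7 : ℤ) 7).filter (fun b => b ≠ 0),
          effPot w₄₅ ω₄ (3 / 400) ‖latPt G hexFrame b‖ +
        ∑ b ∈ (Fintype.piFinset fun _ : Fin 3 => Finset.Icc (-7 : ℤ) 7),
          effPot w₄₅ ω₄ (3 / 400) ‖latPt G hexFrame b + G (hcpShift + ξ)‖) / 2 - (-(7175 / 10000) + 3 / 400)) :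
    HomFloorHcp Zh m := by
  rintro M z c hA ⟨G, ξ, hG, hξ, hZ, hrange⟩
  rcases hhcp G ξ hG hξ hZ with hprune | hfloor
  · rcases hprune M z c hA.1 hrange with hS | hT | hE | hB
    · exact absurd hA.2.1 hS
    · exact absurd hT hA.2.2.2.1
    · exact absurd hE hA.2.2.2.2.1
    · exact absurd hB hA.2.2.2.2.2
  · rw [ballAvg_xRec_eq_latticeSum_hcp hA hrange, latticeSum_hcp_eq_boxSum_record hG hξ]
    exact hfloor

/-- ★★ **`(H∣hcp, Zh)` FROM AN ENERGY FLOOR ON THE ZONE** (no pruning disjunct): `∀ (G, ξ)` admissible IN THE ZONE, `m ≤ (box sums)/2 − e_W` ⟹ `HomFloorHcp Zh m` — the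
socket the per-`U`-box leaves of the frame-local window architecture pay into. [folklore] -/
theorem homFloorHcp_of_boxSum_zone
    (hfloor : ∀ (G : E3 →L[ℝ] E3) (ξ : E3), ‖G - 1‖ ≤ 1 / 4 → ‖ξ‖ ≤ 1 / 4 → Zh G ξ →
      m ≤ (∑ b ∈ (Fintype.piFinset fun _ : Fin 3 => Finset.Icc (-7 : ℤ) 7).filter (fun b => b ≠ 0),
          effPot w₄₅ ω₄ (3 / 400) ‖latPt G hexFrame b‖ +
        ∑ b ∈ (Fintype.piFinset fun _ : Fin 3 => Finset.Icc (-7 : ℤ) 7),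
          effPot w₄₅ ω₄ (3 / 400) ‖latPt G hexFrame b + G (hcpShift + ξ)‖) / 2 - (-(7175 / 10000) + 3 / 400)) :
    HomFloorHcp Zh m :=
  homFloorHcp_of_prunedBoxSum_zone Zh fun G ξ hG hξ hZ => Or.inr (hfloor G ξ hG hξ hZ)

end General

/-! ## §2. Polar-factor (self-adjoint) form on rotation-invariant zones -/

section Polar

variable (Zh : (E3 →L[ℝ] E3) → E3 → Prop) {m : ℝ}

/-- ★★ **POLAR-FACTOR SOCKET WITH PRUNING**: if the zone is invariant under post-composition with linear isometries (`Zh (R ∘ U) ξ → Zh U ξ`) and the pruned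
box-sum certificate holds for every SELF-ADJOINT positive `U` with `‖U − 1‖ ≤ 1/4` and every `‖ξ‖ ≤ 1/4` IN THE ZONE, then `(H∣hcp, Zh)`.
[folklore: `forall_near_one_of_forall_selfAdjoint` + `pruneHcp_comp` + `norm_latPt_comp` / `norm_latPt_add_comp`, as in `prunedBoxSum_hcp_reduction`] -/
theorem homFloorHcp_of_prunedBoxSum_selfAdjoint_zone
    (hZinv : ∀ (R : E3 ≃ₗᵢ[ℝ] E3) (U : E3 →L[ℝ] E3) (ξ : E3), Zh ((R : E3 →L[ℝ] E3).comp U) ξ → Zh U ξ)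
    (hhcp : ∀ (U : E3 →L[ℝ] E3) (ξ : E3), (∀ v w : E3, inner ℝ (U v) w = inner ℝ v (U w)) → (∀ w : E3, 0 ≤ inner ℝ w (U w)) →
      ‖U - 1‖ ≤ 1 / 4 → ‖ξ‖ ≤ 1 / 4 → Zh U ξ →
      (∀ (M : ℕ) (z : Fin M → E3) (c : Fin M), Function.Injective z →
          Set.range z = {x : E3 | dist x (z c) ≤ 133 / 10 ∧ ∃ a : Fin 3 → ℤ,
            x = z c + latPt U hexFrame a ∨ x = z c + latPt U hexFrame a + U (hcpShift + ξ)} →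
          TightNearCap (9 / 5) (3 / 2) z c ∨ ExemptNear (9 / 5) ExRec z c ∨ BadNearCap (9 / 5) (3 / 2) z c) ∨
      m ≤ (∑ b ∈ (Fintype.piFinset fun _ : Fin 3 => Finset.Icc (-7 : ℤ) 7).filter (fun b => b ≠ 0),
          effPot w₄₅ ω₄ (3 / 400) ‖latPt U hexFrame b‖ +
        ∑ b ∈ (Fintype.piFinset fun _ : Fin 3 => Finset.Icc (-7 : ℤ) 7),
          effPot w₄₅ ω₄ (3 / 400) ‖latPt U hexFrame b + U (hcpShift + ξ)‖) / 2 - (-(7175 / 10000) + 3 / 400)) :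
    HomFloorHcp Zh m := by
  refine homFloorHcp_of_prunedBoxSum_zone Zh fun G ξ hG hξ hZ => ?_
  have key : ∀ G : E3 →L[ℝ] E3, ‖G - 1‖ ≤ 1 / 4 → (‖ξ‖ ≤ 1 / 4 → Zh G ξ →
      (∀ (M : ℕ) (z : Fin M → E3) (c : Fin M), Function.Injective z →
          Set.range z = {x : E3 | dist x (z c) ≤ 133 / 10 ∧ ∃ a : Fin 3 → ℤ,
            x = z c + latPt G hexFrame a ∨ x = z c + latPt G hexFrame a + G (hcpShift + ξ)} →
          TightNearCap (9 / 5) (3 / 2) z c ∨ ExemptNear (9 / 5) ExRec z c ∨ BadNearCap (9 / 5) (3 / 2) z c) ∨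
      m ≤ (∑ b ∈ (Fintype.piFinset fun _ : Fin 3 => Finset.Icc (-7 : ℤ) 7).filter (fun b => b ≠ 0),
          effPot w₄₅ ω₄ (3 / 400) ‖latPt G hexFrame b‖ +
        ∑ b ∈ (Fintype.piFinset fun _ : Fin 3 => Finset.Icc (-7 : ℤ) 7),
          effPot w₄₅ ω₄ (3 / 400) ‖latPt G hexFrame b + G (hcpShift + ξ)‖) / 2 - (-(7175 / 10000) + 3 / 400)) := by
    refine forall_near_one_of_forall_selfAdjoint ?_ (fun U hsa hpos hU1 hξ' hZ' => hhcp U ξ hsa hpos hU1 hξ' hZ')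
    rintro R U h hξ' hZ'
    rcases h hξ' (hZinv R U ξ hZ') with h | h
    · exact Or.inl (pruneHcp_comp R U hexFrame (hcpShift + ξ) (133 / 10) h)
    · right; simpa only [norm_latPt_comp, norm_latPt_add_comp] using h
  exact (key G hG hξ hZ).imp (fun h M z c hz hr => Or.inr (h M z c hz hr)) id

/-- ★★ **POLAR-FACTOR SOCKET, PURE ENERGY FORM**: rotation-invariant zone + the box-sum floor for every self-adjoint positive `U` near `1` and `‖ξ‖ ≤ 1/4` IN THE ZONE
⟹ `(H∣hcp, Zh)`. [folklore] -/
theorem homFloorHcp_of_boxSum_selfAdjoint_zone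
    (hZinv : ∀ (R : E3 ≃ₗᵢ[ℝ] E3) (U : E3 →L[ℝ] E3) (ξ : E3), Zh ((R : E3 →L[ℝ] E3).comp U) ξ → Zh U ξ)
    (hfloor : ∀ (U : E3 →L[ℝ] E3) (ξ : E3), (∀ v w : E3, inner ℝ (U v) w = inner ℝ v (U w)) → (∀ w : E3, 0 ≤ inner ℝ w (U w)) →
      ‖U - 1‖ ≤ 1 / 4 → ‖ξ‖ ≤ 1 / 4 → Zh U ξ →
      m ≤ (∑ b ∈ (Fintype.piFinset fun _ : Fin 3 => Finset.Icc (-7 : ℤ) 7).filter (fun b => b ≠ 0),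
          effPot w₄₅ ω₄ (3 / 400) ‖latPt U hexFrame b‖ +
        ∑ b ∈ (Fintype.piFinset fun _ : Fin 3 => Finset.Icc (-7 : ℤ) 7),
          effPot w₄₅ ω₄ (3 / 400) ‖latPt U hexFrame b + U (hcpShift + ξ)‖) / 2 - (-(7175 / 10000) + 3 / 400)) :
    HomFloorHcp Zh m :=
  homFloorHcp_of_prunedBoxSum_selfAdjoint_zone Zh hZinv fun U ξ hsa hpos hU1 hξ hZ => Or.inr (hfloor U ξ hsa hpos hU1 hξ hZ)

/-- ★ **ZONES OF RECORD ARE ROTATION-INVARIANT**: any zone that reads `G` only through the bond-length function `v ↦ ‖G v‖` (Gram data: `BondCap`, `Dense`, the E-zone,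
`U`-boxes in Gram coordinates) satisfies the invariance hypothesis of the polar-factor sockets. [`LinearIsometry.norm_map`] -/
theorem zoneInvariant_of_norm_map {Zh : (E3 →L[ℝ] E3) → E3 → Prop}
    (hZ : ∀ (G G' : E3 →L[ℝ] E3) (ξ : E3), (∀ v : E3, ‖G v‖ = ‖G' v‖) → Zh G ξ → Zh G' ξ)
    (R : E3 ≃ₗᵢ[ℝ] E3) (U : E3 →L[ℝ] E3) (ξ : E3) (h : Zh ((R : E3 →L[ℝ] E3).comp U) ξ) : Zh U ξ :=
  hZ _ U ξ (fun v => by simp) h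

end Polar

/-! ## §3. ★★★ The two dispatch fibres by name -/

section Fibres

variable {box : (E3 →L[ℝ] E3) → Prop} {σ : (E3 →L[ℝ] E3) → E3} {R₀ m : ℝ} {a b : Fin 3 → ℝ}

/-- ★★★ **THE NEAR FIBRE** (`hNear` of #44 `homFloorHcp_of_dispatch`): an energy floor on the LEAF BALL `box G ∧ ‖ξ − σ G‖ ≤ R₀` (lens-5 g106 «SignedXiElim»
`hcpEnergy_of_ballLeaves_signed`, hand-1 `loew_box_floor` / `loew_full_floor`, all read as box-sum floors) ⟹ `HomFloorHcp (box G ∧ ‖ξ − σ G‖ ≤ R₀) m`. [§1] -/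
theorem homFloorHcp_leafBall_of_boxSum
    (hfloor : ∀ (G : E3 →L[ℝ] E3) (ξ : E3), ‖G - 1‖ ≤ 1 / 4 → ‖ξ‖ ≤ 1 / 4 → box G → ‖ξ - σ G‖ ≤ R₀ →
      m ≤ (∑ b ∈ (Fintype.piFinset fun _ : Fin 3 => Finset.Icc (-7 : ℤ) 7).filter (fun b => b ≠ 0),
          effPot w₄₅ ω₄ (3 / 400) ‖latPt G hexFrame b‖ +
        ∑ b ∈ (Fintype.piFinset fun _ : Fin 3 => Finset.Icc (-7 : ℤ) 7),
          effPot w₄₅ ω₄ (3 / 400) ‖latPt G hexFrame b + G (hcpShift + ξ)‖) / 2 - (-(7175 / 10000) + 3 / 400)) :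
    HomFloorHcp (fun G ξ => box G ∧ ‖ξ - σ G‖ ≤ R₀) m :=
  homFloorHcp_of_boxSum_zone _ fun G ξ hG hξ hZ => hfloor G ξ hG hξ hZ.1 hZ.2

/-- ★★★ **THE NEAR FIBRE, POLAR-FACTOR FORM** (leaves computed on self-adjoint `U`; `box` and `σ` rotation-invariant, e.g. functions of the Gram data). [§2] -/
theorem homFloorHcp_leafBall_of_boxSum_selfAdjoint
    (hbox : ∀ (R : E3 ≃ₗᵢ[ℝ] E3) (U : E3 →L[ℝ] E3), box ((R : E3 →L[ℝ] E3).comp U) → box U)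
    (hσ : ∀ (R : E3 ≃ₗᵢ[ℝ] E3) (U : E3 →L[ℝ] E3), σ ((R : E3 →L[ℝ] E3).comp U) = σ U)
    (hfloor : ∀ (U : E3 →L[ℝ] E3) (ξ : E3), (∀ v w : E3, inner ℝ (U v) w = inner ℝ v (U w)) → (∀ w : E3, 0 ≤ inner ℝ w (U w)) →
      ‖U - 1‖ ≤ 1 / 4 → ‖ξ‖ ≤ 1 / 4 → box U → ‖ξ - σ U‖ ≤ R₀ →
      m ≤ (∑ b ∈ (Fintype.piFinset fun _ : Fin 3 => Finset.Icc (-7 : ℤ) 7).filter (fun b => b ≠ 0),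
          effPot w₄₅ ω₄ (3 / 400) ‖latPt U hexFrame b‖ +
        ∑ b ∈ (Fintype.piFinset fun _ : Fin 3 => Finset.Icc (-7 : ℤ) 7),
          effPot w₄₅ ω₄ (3 / 400) ‖latPt U hexFrame b + U (hcpShift + ξ)‖) / 2 - (-(7175 / 10000) + 3 / 400)) :
    HomFloorHcp (fun G ξ => box G ∧ ‖ξ - σ G‖ ≤ R₀) m :=
  homFloorHcp_of_boxSum_selfAdjoint_zone _ (fun R U _ h => ⟨hbox R U h.1, hσ R U ▸ h.2⟩)
    fun U ξ hsa hpos hU1 hξ hZ => hfloor U ξ hsa hpos hU1 hξ hZ.1 hZ.2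

/-- ★★★ **THE FAR FIBRE** (`hFar` of #44): an energy floor on the PRODUCT BOX `box G ∧ ∀ i, |ξ_i − a_i| ≤ b_i` (a VALUE leaf on (`U`-box) × (ξ-box)) ⟹
`HomFloorHcp (box G ∧ ∀ i, |ξ_i − a_i| ≤ b_i) m`. [§1] -/
theorem homFloorHcp_productBox_of_boxSum
    (hfloor : ∀ (G : E3 →L[ℝ] E3) (ξ : E3), ‖G - 1‖ ≤ 1 / 4 → ‖ξ‖ ≤ 1 / 4 → box G → (∀ i, |ξ i - a i| ≤ b i) →
      m ≤ (∑ b ∈ (Fintype.piFinset fun _ : Fin 3 => Finset.Icc (-7 : ℤ) 7).filter (fun b => b ≠ 0),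
          effPot w₄₅ ω₄ (3 / 400) ‖latPt G hexFrame b‖ +
        ∑ b ∈ (Fintype.piFinset fun _ : Fin 3 => Finset.Icc (-7 : ℤ) 7),
          effPot w₄₅ ω₄ (3 / 400) ‖latPt G hexFrame b + G (hcpShift + ξ)‖) / 2 - (-(7175 / 10000) + 3 / 400)) :
    HomFloorHcp (fun G ξ => box G ∧ ∀ i, |ξ i - a i| ≤ b i) m :=
  homFloorHcp_of_boxSum_zone _ fun G ξ hG hξ hZ => hfloor G ξ hG hξ hZ.1 hZ.2

/-- ★★★ **THE FAR FIBRE, POLAR-FACTOR FORM** (`box` rotation-invariant; the ξ-box does not read `G`). [§2] -/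
theorem homFloorHcp_productBox_of_boxSum_selfAdjoint
    (hbox : ∀ (R : E3 ≃ₗᵢ[ℝ] E3) (U : E3 →L[ℝ] E3), box ((R : E3 →L[ℝ] E3).comp U) → box U)
    (hfloor : ∀ (U : E3 →L[ℝ] E3) (ξ : E3), (∀ v w : E3, inner ℝ (U v) w = inner ℝ v (U w)) → (∀ w : E3, 0 ≤ inner ℝ w (U w)) →
      ‖U - 1‖ ≤ 1 / 4 → ‖ξ‖ ≤ 1 / 4 → box U → (∀ i, |ξ i - a i| ≤ b i) →
      m ≤ (∑ b ∈ (Fintype.piFinset fun _ : Fin 3 => Finset.Icc (-7 : ℤ) 7).filter (fun b => b ≠ 0),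
          effPot w₄₅ ω₄ (3 / 400) ‖latPt U hexFrame b‖ +
        ∑ b ∈ (Fintype.piFinset fun _ : Fin 3 => Finset.Icc (-7 : ℤ) 7),
          effPot w₄₅ ω₄ (3 / 400) ‖latPt U hexFrame b + U (hcpShift + ξ)‖) / 2 - (-(7175 / 10000) + 3 / 400)) :
    HomFloorHcp (fun G ξ => box G ∧ ∀ i, |ξ i - a i| ≤ b i) m :=
  homFloorHcp_of_boxSum_selfAdjoint_zone _ (fun R U _ h => ⟨hbox R U h.1, h.2⟩)
    fun U ξ hsa hpos hU1 hξ hZ => hfloor U ξ hsa hpos hU1 hξ hZ.1 hZ.2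

end Fibres

end Summit.AtomisticToContinuum.Crystallization.Theorems.FrustratedLawDichotomyStrainedPatchHomFloorHcpZone

end
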